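import Summits.QuantumFields.YangMills.Theorems.SwapVirialDeficitZeroModeSigmaFourSmallBallHubCap
import Summits.QuantumFields.YangMills.Theorems.SwapVirialDeficitLaplaceAbelianLimit
import HarnessLib

/-!
# Exact zero-mode rung Z5 — the σ-TWISTED FOUR-LEADER small ball, XII: the HUB-TIP SHARE is a POWER of the tip width, uniformly in the scale
# (LEAD ym-line-sfw-p2 g97's brick W6 (T4) «L-independent σ-block tip share» of the steep-window Morse–Bott plan for ⟨stmt-QuantumFields-24197⟩;
# free-hands support of ⟨24197⟩ `SwapVirialDeficit.SwapGluedStiffness`)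

The steep-window plan (HOME `sfw-p2-g97-memo-24197-steep-window-morse-bott.md` §1 (B-tip)) discards the hub tips `ψ(a) < ψ₀` and `ψ(a) > π/2 − ψ₀` of the
σ-glued valley with a CRUDE share bound; its `L`-independent input (T4) is: the σ-twisted four-leader small ball `E_σ(t) ⊆ SU(2)⁴` (✓`sigmaBall`) restricted to
seam letters `C 3` whose unit quaternion `u` has `|re u|·‖Im u‖ < ε` (both tips at once: `|re u|·‖Im u‖ = |sin 2ψ|/2`) has Haar measure `≤ W(ε)·t⁷` with
`W(ε) = O(ε^{1/36})`, for EVERY `t > 0` — no rate in `t` is needed, because the `t`-independent dominator of part III (✓`indicator_rescaledSigma_axis_le_sigmaDom`,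
✓`lintegral_sigmaDom_le`) bounds every rescaled hub fibre by the hub weight `hubW`, whose cone-cap integral is a power of `ε` (part XI ✓`lintegral_cone_cap_hubW_le`).
* §50 the reduction chain of parts I–II (cone model → arranged → straightened → translated → hub Tonelli) RESTRICTED TO A HUB SET `{su2Quat (C 3) ∈ S}`:
  every skew map of the chain fixes the hub, so ★ `haar_sigmaBall_inter_hub_eq_lintegral`:
  `Haar⁴(E_σ(t) ∩ {su2Quat(C 3) ∈ S}) = ∫_{radialUnit a ∈ S} coneThree(transSet t A(a)) dcone(a)`;
* §51 ★ `coneThree_transSet_le_hubW` — cone-a.e. in the hub, `coneThree(transSet t A(a)) ≤ t⁷·coneConst³·C_dom·hubW(a)` for EVERY `t > 0`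
  (`C_dom = 4·(π²/12)·I(1/3)²·16e⁴`); `radialUnit_tip_subset_cap` — on the unit ball the unit-hub tip `{|re û|·‖Im û‖ < ε}` lies in the raw cap `{|a₀|·‖Im a‖ < ε}`;
* §52 ★★★ `haar_sigmaBall_inter_hubTip_le` — THE TIP SHARE IN VOLUME FORM: for all `t > 0`, `ε > 0`,
  `Haar⁴(E_σ(t) ∩ Tip_ε) ≤ t⁷ · coneConst³·C_dom·Cap(ε)`, `Cap(ε) = coneConst·(ε^{1/18}c₁ + ε^{1/36}c₂)` the constant of ✓`lintegral_cone_cap_hubW_le`;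
* §53 ★★★ `lintegral_hubTip_exp_neg_sigmaMaxSq_le` — THE TIP SHARE IN LAPLACE FORM: for all `β > 0`, `ε > 0`,
  `∫_{Tip_ε} e^{−β·sigmaMaxSq(C)} dHaar⁴(C) ≤ Γ(9/2)·β^{−7/2}·coneConst³·C_dom·Cap(ε)` (layer cake ✓`lintegral_exp_neg_mul_eq_layerCake` + §52 at `t = √s`);
  `tipConst_lt_top` — all constants are finite.
So (T4) holds with `V_tip(ψ₀) ≤ C·ε^{1/36}` (`ε = sin(2ψ₀)/2`) and NO `b'^{−κ'}` term at all.

HONEST LABEL: finite-dimensional real analysis on `SU(2)⁴` (plan-level zero-mode input of a DRAFT line); not the model-side tip bound (B-tip) itself ((T1)–(T3) and the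
cell assembly are separate bricks), NOT ⟨24197⟩; ⟨24197⟩ ∕ ⟨24196⟩ ∕ ⟨24194⟩ ∕ ⟨24497⟩ OPEN; own crux ⟨22884⟩ OPEN (blocked-on ⟨19935⟩); the Yang–Mills mass gap is NOT
proved; no summit is proved by a line.  Width seat ym-line-sfw-p2-w2 g58 (cell ym-idea-1, free hands), `--supports stmt-QuantumFields-24197`.  THEOREMS ONLY,
standard axioms, 0 `sorry`.  References: [cite: GonzalezarroyoAltes1988]; [cite: Vanbaal2001]; [cite: Luscher1983, §2]; [folklore].
-/

set_option autoImplicit false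

noncomputable section

open MeasureTheory Quaternion Set
open scoped Quaternion ENNReal BigOperators
open Literature.MathematicalPhysics.QuantumLattice
open Literature.MathematicalPhysics.QuantumFieldTheory (haarProbability)
open Literature.Analysis.Calculus (radialUnit radialUnit_def norm_radialUnit)
open Literature.MathematicalPhysics.QuantumFieldTheory.Balaban1983to89.T4HaarSU2Translate (continuous_su2Quat)
open Summit.QuantumFields.YangMills.Theorems.SwapVirialDeficit.Abelian (sigmaMaxSq measurable_sigmaMaxSq setOf_sigmaMaxSq_le
  lintegral_exp_neg_mul_eq_layerCake)
open Summit.QuantumFields.YangMills.Theorems.SwapTwistDeficit.ToronLog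
open Summit.QuantumFields.YangMills.Theorems.SwapVirialDeficit.ZeroModeGroup

attribute [local instance] Literature.Analysis.FluidPDE.Tao2016.quatMeasurableSpace
  Literature.Analysis.FluidPDE.Tao2016.quatBorelSpace
  Literature.MathematicalPhysics.QuantumLattice.secondCountableTopology_su2

namespace Summit.QuantumFields.YangMills.Theorems.SwapVirialDeficit.ZeroModeSigma

/-! ## §50 The reduction chain restricted to a hub set -/

/-- The hub set on the cone side `{v | radialUnit (v 3) ∈ S}` and on the arranged side `{q | radialUnit q.1 ∈ S}` are measurable. [folklore] -/
theorem measurableSet_hubSet {S : Set ℍ} (hS : MeasurableSet S) :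
    MeasurableSet {q : ℍ × ((ℍ × ℍ) × ℍ) | radialUnit q.1 ∈ S} ∧ MeasurableSet {a : ℍ | radialUnit a ∈ S} ∧
      MeasurableSet {C : Fin 4 → Matrix.specialUnitaryGroup (Fin 2) ℂ | su2Quat (C 3) ∈ S} :=
  ⟨(measurable_radialUnit.comp measurable_fst) hS, measurable_radialUnit hS,
    (continuous_su2Quat.measurable.comp (measurable_pi_apply 3)) hS⟩

/-- Step 1–2: `Haar⁴(E_σ(t) ∩ {su2Quat (C 3) ∈ S}) = coneFour (prodSigma t ∩ {radialUnit q.1 ∈ S})` (`t ≥ 0`). [folklore] -/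
theorem haar_sigmaBall_inter_hub_eq_prod {t : ℝ} (ht : 0 ≤ t) {S : Set ℍ} (hS : MeasurableSet S) :
    (Measure.pi fun _ : Fin 4 => haarProbability (Matrix.specialUnitaryGroup (Fin 2) ℂ))
        (sigmaBall t ∩ {C | su2Quat (C 3) ∈ S}) = coneFour (prodSigma t ∩ {q | radialUnit q.1 ∈ S}) := by
  haveI := isProbabilityMeasure_coneMeasure
  obtain ⟨hH₁, -, hT⟩ := measurableSet_hubSet hS
  -- to the cone model
  have h1 : (Measure.pi fun _ : Fin 4 => haarProbability (Matrix.specialUnitaryGroup (Fin 2) ℂ)) (sigmaBall t ∩ {C | su2Quat (C 3) ∈ S}) =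
      (Measure.pi fun _ : Fin 4 => coneMeasure) (coneSigma t ∩ {v : Fin 4 → ℍ | radialUnit (v 3) ∈ S}) := by
    rw [← measurePreserving_proj.measure_preimage ((measurableSet_sigmaBall t).inter hT).nullMeasurableSet]
    refine measure_congr ?_
    filter_upwards [ae_ne_zero_pi_four] with v hv
    simp only [eq_iff_iff]
    change (fun μ => quatToSU2 (v μ)) ∈ sigmaBall t ∩ {C | su2Quat (C 3) ∈ S} ↔ v ∈ coneSigma t ∩ {v : Fin 4 → ℍ | radialUnit (v 3) ∈ S}
    rw [sigmaBall_eq_preimage_sigmaSet ht]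
    simp only [coneSigma, Set.mem_inter_iff, Set.mem_setOf_eq, su2Quat_quatToSU2_eq_radialUnit (hv 0), su2Quat_quatToSU2_eq_radialUnit (hv 1),
      su2Quat_quatToSU2_eq_radialUnit (hv 2), su2Quat_quatToSU2_eq_radialUnit (hv 3)]
  -- arrange
  have h2 : coneSigma t ∩ {v : Fin 4 → ℍ | radialUnit (v 3) ∈ S} = arrange ⁻¹' (prodSigma t ∩ {q | radialUnit q.1 ∈ S}) := by
    rw [Set.preimage_inter, ← coneSigma_eq_preimage]; rfl
  rw [h1, h2, measurePreserving_arrange.measure_preimage ((measurableSet_prodSigma t).inter hH₁).nullMeasurableSet]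

/-- Step 3: hub straightening fixes the hub: `coneFour (prodSigma t ∩ H) = coneFour (axisSigma t ∩ H)`, `H = {radialUnit q.1 ∈ S}`. [folklore] -/
theorem coneFour_prodSigma_inter_hub_eq_axisSigma (t : ℝ) {S : Set ℍ} (hS : MeasurableSet S) :
    coneFour (prodSigma t ∩ {q | radialUnit q.1 ∈ S}) = coneFour (axisSigma t ∩ {q | radialUnit q.1 ∈ S}) := by
  obtain ⟨hH₁, -, -⟩ := measurableSet_hubSet hS
  rw [← measurePreserving_straighten.measure_preimage ((measurableSet_axisSigma t).inter hH₁).nullMeasurableSet]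
  refine measure_congr ?_
  filter_upwards [ae_coneFour_good] with q hq
  obtain ⟨ha, -, -, -, -⟩ := hq
  have hu : ‖hubUnit q.1‖ = 1 := norm_unitConeQ ha
  simp only [eq_iff_iff]
  change q ∈ prodSigma t ∩ {q | radialUnit q.1 ∈ S} ↔ (q.1, conj3 (hubUnit q.1) q.2) ∈ axisSigma t ∩ {q | radialUnit q.1 ∈ S}
  simp only [prodSigma, axisSigma, conj3, Set.mem_inter_iff, Set.mem_setOf_eq]
  rw [radialUnit_conj hu, radialUnit_conj hu, radialUnit_conj hu, ← conj_hubUnit_radialUnit ha, mem_sigmaSet_conj hu]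

/-- Step 4: the slaved-letter translation fixes the hub: `coneFour (axisSigma t ∩ H) = coneFour (transSigma t ∩ H)`. [folklore] -/
theorem coneFour_axisSigma_inter_hub_eq_transSigma (t : ℝ) {S : Set ℍ} (hS : MeasurableSet S) :
    coneFour (axisSigma t ∩ {q | radialUnit q.1 ∈ S}) = coneFour (transSigma t ∩ {q | radialUnit q.1 ∈ S}) := by
  obtain ⟨hH₁, -, -⟩ := measurableSet_hubSet hS
  rw [← measurePreserving_translate_skew.measure_preimage ((measurableSet_axisSigma t).inter hH₁).nullMeasurableSet]
  refine measure_congr ?_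
  filter_upwards [ae_coneFour_good] with q hq
  obtain ⟨-, ha, hx, -, -⟩ := hq
  have hp : ‖slaveP (radialUnit (axisPoint q.1)) q.2.1.1‖ = 1 := norm_slaveP (norm_axisUnit ha) hx
  simp only [eq_iff_iff]
  change (q.1, translate (radialUnit (axisPoint q.1)) q.2) ∈ axisSigma t ∩ {q | radialUnit q.1 ∈ S} ↔ q ∈ transSigma t ∩ {q | radialUnit q.1 ∈ S}
  simp only [axisSigma, transSigma, translate, Set.mem_inter_iff, Set.mem_setOf_eq, radialUnit_mul_left hp]

/-- ★ Step 5 (hub Tonelli on the restricted event): for `t ≥ 0` and a measurable hub set `S`,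
`Haar⁴(E_σ(t) ∩ {su2Quat (C 3) ∈ S}) = ∫_{ {a | radialUnit a ∈ S} } coneThree (transSet t (radialUnit (axisPoint a))) dcone(a)`. [folklore] -/
theorem haar_sigmaBall_inter_hub_eq_lintegral {t : ℝ} (ht : 0 ≤ t) {S : Set ℍ} (hS : MeasurableSet S) :
    (Measure.pi fun _ : Fin 4 => haarProbability (Matrix.specialUnitaryGroup (Fin 2) ℂ))
        (sigmaBall t ∩ {C | su2Quat (C 3) ∈ S}) =
      ∫⁻ a in {a : ℍ | radialUnit a ∈ S}, coneThree (transSet t (radialUnit (axisPoint a))) ∂coneMeasure := by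
  haveI := isProbabilityMeasure_coneMeasure
  haveI := isProbabilityMeasure_coneThree
  obtain ⟨hH₁, hH, -⟩ := measurableSet_hubSet hS
  rw [haar_sigmaBall_inter_hub_eq_prod ht hS, coneFour_prodSigma_inter_hub_eq_axisSigma t hS, coneFour_axisSigma_inter_hub_eq_transSigma t hS,
    coneFour, Measure.prod_apply ((measurableSet_transSigma t).inter hH₁), ← lintegral_indicator hH]
  refine lintegral_congr fun a => ?_
  by_cases ha : radialUnit a ∈ S
  · have hsec : Prod.mk a ⁻¹' (transSigma t ∩ {q : ℍ × ((ℍ × ℍ) × ℍ) | radialUnit q.1 ∈ S}) = transSet t (radialUnit (axisPoint a)) := by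
      ext w
      simp only [Set.mem_preimage, Set.mem_inter_iff, Set.mem_setOf_eq, ha, and_true]
      rfl
    rw [hsec, Set.indicator_of_mem (show a ∈ {a : ℍ | radialUnit a ∈ S} from ha)]
  · have hsec : Prod.mk a ⁻¹' (transSigma t ∩ {q : ℍ × ((ℍ × ℍ) × ℍ) | radialUnit q.1 ∈ S}) = ∅ := by
      ext w
      simp only [Set.mem_preimage, Set.mem_inter_iff, Set.mem_setOf_eq, ha, and_false, Set.mem_empty_iff_false]
    rw [hsec, measure_empty, Set.indicator_of_notMem (show a ∉ {a : ℍ | radialUnit a ∈ S} from ha)]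

/-! ## §51 The per-hub dominator bound, uniform in the scale, and the tip–cap inclusion -/

/-- `vol³`-almost every triple has a non-zero first letter. [folklore] -/
theorem ae_volume3_fst_ne_zero : ∀ᵐ w : (ℍ × ℍ) × ℍ ∂(volume : Measure ((ℍ × ℍ) × ℍ)), w.1.1 ≠ 0 := by
  rw [ae_iff]
  have hsub : {w : (ℍ × ℍ) × ℍ | ¬ w.1.1 ≠ 0} ⊆ (({0} : Set ℍ) ×ˢ (univ : Set ℍ)) ×ˢ (univ : Set ℍ) := by
    intro w hw
    simp only [ne_eq, not_not, Set.mem_setOf_eq] at hw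
    simp [hw]
  refine measure_mono_null hsub ?_
  rw [show (volume : Measure ((ℍ × ℍ) × ℍ)) = ((volume : Measure ℍ).prod volume).prod volume from rfl,
    Measure.prod_prod, Measure.prod_prod, measure_singleton, zero_mul, zero_mul]

/-- ★ **The per-hub dominator bound, uniform in `t`**: for every `t > 0`, cone-a.e. in the hub `a`,
`coneThree (transSet t A(a)) ≤ t⁷ · coneConst³ · (4·(π²/12)·I(1/3)²·16e⁴) · hubW(a)` — every rescaled hub fibre is dominated by the `t`-independent
dominator of part III, whose `vol³`-integral is the hub constant `≤ (π²/12)·hubW`. [folklore] -/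
theorem coneThree_transSet_le_hubW {t : ℝ} (ht : 0 < t) :
    ∀ᵐ a ∂coneMeasure, coneThree (transSet t (radialUnit (axisPoint a))) ≤
      ENNReal.ofReal (t ^ 7) * (ENNReal.ofReal coneConst ^ 3 *
        ((4 * (ENNReal.ofReal (Real.pi ^ 2 / 12) * (Ising (1/3) * Ising (1/3))) * (16 * ENNReal.ofReal (Real.exp 4))) * hubW a)) := by
  filter_upwards [ae_cone_hub_good] with a ha
  obtain ⟨hre, him, hn⟩ := ha
  have ha0 : a ≠ 0 := by intro h; rw [h] at hre; exact hre rfl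
  rw [coneThree_transSet ht]
  gcongr ENNReal.ofReal (t ^ 7) * (ENNReal.ofReal coneConst ^ 3 * ?_)
  -- `vol³(rescaledSigma) ≤ ∫ sigmaDom ≤ C_dom · hubW a`
  have hvol : volume (rescaledSigma t (radialUnit (axisPoint a))) ≤
      ∫⁻ w, sigmaDom (radialUnit (axisPoint a)) w ∂(((volume : Measure ℍ).prod volume).prod volume) := by
    rw [← lintegral_indicator_one (measurableSet_rescaledSigma t _),
      show (volume : Measure ((ℍ × ℍ) × ℍ)) = ((volume : Measure ℍ).prod volume).prod volume from rfl]
    refine lintegral_mono_ae ?_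
    filter_upwards [ae_volume3_fst_ne_zero] with w hw
    exact indicator_rescaledSigma_axis_le_sigmaDom ht ha0 w hw
  obtain ⟨eR, eM⟩ := axisUnit_sq a
  have hN : 0 < ‖a‖ ^ 2 := by positivity
  have hα : (radialUnit (axisPoint a)).re ≠ 0 := by
    intro h0; rw [h0] at eR
    have : a.re ^ 2 / ‖a‖ ^ 2 = 0 := by rw [← eR]; ring
    rw [div_eq_zero_iff] at this
    rcases this with h | h
    · exact hre (pow_eq_zero_iff two_ne_zero |>.1 h)
    · exact hN.ne' h
  have hβ : (radialUnit (axisPoint a)).imI ≠ 0 := by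
    intro h0; rw [h0] at eM
    have : ‖a.im‖ ^ 2 / ‖a‖ ^ 2 = 0 := by rw [← eM]; ring
    rw [div_eq_zero_iff] at this
    rcases this with h | h
    · exact him (norm_eq_zero.1 (pow_eq_zero_iff two_ne_zero |>.1 h))
    · exact hN.ne' h
  have h1 := axial_sq_add_sq (norm_axisUnit ha0) (axisUnit_axial a).1 (axisUnit_axial a).2
  have hmain := lintegral_sigmaDom_le h1 hα hβ
  have hK := ofReal_hubK_axis_le hn.le
  calc volume (rescaledSigma t (radialUnit (axisPoint a)))
      ≤ ∫⁻ w, sigmaDom (radialUnit (axisPoint a)) w ∂(((volume : Measure ℍ).prod volume).prod volume) := hvol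
    _ ≤ 4 * (ENNReal.ofReal (hubK (radialUnit (axisPoint a)).re (radialUnit (axisPoint a)).imI) * (Ising (1/3) * Ising (1/3))) *
          (16 * ENNReal.ofReal (Real.exp 4)) := hmain
    _ ≤ 4 * ((ENNReal.ofReal (Real.pi ^ 2 / 12) * hubW a) * (Ising (1/3) * Ising (1/3))) * (16 * ENNReal.ofReal (Real.exp 4)) := by
        gcongr
    _ = (4 * (ENNReal.ofReal (Real.pi ^ 2 / 12) * (Ising (1/3) * Ising (1/3))) * (16 * ENNReal.ofReal (Real.exp 4))) * hubW a := by ring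

/-- ★ **Tip ⊆ cap on the unit ball**: if `0 < ‖a‖ ≤ 1` and the UNIT hub `û = a/‖a‖` has `|re û|·‖Im û‖ < ε`, then `|a₀|·‖Im a‖ < ε`
(`|re û|·‖Im û‖ = |a₀|·‖Im a‖/‖a‖² ≥ |a₀|·‖Im a‖`). [folklore] -/
theorem radialUnit_tip_subset_cap {a : ℍ} (ha0 : a ≠ 0) (ha1 : ‖a‖ ≤ 1) {ε : ℝ}
    (h : |(radialUnit a).re| * ‖(radialUnit a).im‖ < ε) : |a.re| * ‖a.im‖ < ε := by
  have hn : 0 < ‖a‖ := norm_pos_iff.2 ha0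
  have hre : (radialUnit a).re = ‖a‖⁻¹ * a.re := by rw [radialUnit_def, Quaternion.re_smul, smul_eq_mul]
  have him : (radialUnit a).im = ‖a‖⁻¹ • a.im := by rw [radialUnit_def, Quaternion.im_smul]
  rw [hre, him, norm_smul, norm_inv, norm_norm, abs_mul, abs_inv, abs_norm] at h
  have hinv : 1 ≤ ‖a‖⁻¹ := one_le_inv_iff₀.2 ⟨hn, ha1⟩
  have h1 : |a.re| * ‖a.im‖ ≤ ‖a‖⁻¹ * |a.re| * (‖a‖⁻¹ * ‖a.im‖) := by
    have e1 : |a.re| ≤ ‖a‖⁻¹ * |a.re| := le_mul_of_one_le_left (abs_nonneg _) hinv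
    have e2 : ‖a.im‖ ≤ ‖a‖⁻¹ * ‖a.im‖ := le_mul_of_one_le_left (norm_nonneg _) hinv
    exact mul_le_mul e1 e2 (norm_nonneg _) (by positivity)
  exact lt_of_le_of_lt h1 h

/-! ## §52 The tip share in volume form -/

/-- ★★★ **THE HUB-TIP SHARE OF THE σ-TWISTED SMALL BALL IS A POWER OF THE TIP WIDTH, UNIFORMLY IN THE SCALE**: for all `t > 0`, `ε > 0`,
`Haar⁴(E_σ(t) ∩ {C : |re u₃|·‖Im u₃‖ < ε}) ≤ t⁷ · coneConst³ · C_dom · coneConst·(ε^{1/18}·3^{−4/3}I(7/18)I(4/9)³ + ε^{1/36}·3^{−4/3}I(1/3)I(17/36)I(4/9)²)`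
(`u₃ = su2Quat (C 3)` the seam letter; both hub tips `ψ → 0` and `ψ → π/2` at once). [cite: GonzalezarroyoAltes1988] [cite: Vanbaal2001] -/
theorem haar_sigmaBall_inter_hubTip_le {t ε : ℝ} (ht : 0 < t) (hε : 0 < ε) :
    (Measure.pi fun _ : Fin 4 => haarProbability (Matrix.specialUnitaryGroup (Fin 2) ℂ))
        (sigmaBall t ∩ {C | |(su2Quat (C 3)).re| * ‖(su2Quat (C 3)).im‖ < ε}) ≤
      ENNReal.ofReal (t ^ 7) * (ENNReal.ofReal coneConst ^ 3 *
        ((4 * (ENNReal.ofReal (Real.pi ^ 2 / 12) * (Ising (1/3) * Ising (1/3))) * (16 * ENNReal.ofReal (Real.exp 4))) *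
          (ENNReal.ofReal coneConst * (ENNReal.ofReal (ε ^ (1/18 : ℝ) * (3:ℝ) ^ (-(4/3 : ℝ))) * (Ising (7/18) * (Ising (4/9) * (Ising (4/9) * Ising (4/9)))) +
            ENNReal.ofReal (ε ^ (1/36 : ℝ) * (3:ℝ) ^ (-(4/3 : ℝ))) * (Ising (1/3) * (Ising (17/36) * (Ising (4/9) * Ising (4/9)))))))) := by
  set S : Set ℍ := {u : ℍ | |u.re| * ‖u.im‖ < ε} with hSdef
  have hS : MeasurableSet S := measurableSet_lt ((measurable_quat_re.abs).mul measurable_quat_im.norm) measurable_const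
  set Cdom : ℝ≥0∞ := (4 * (ENNReal.ofReal (Real.pi ^ 2 / 12) * (Ising (1/3) * Ising (1/3))) * (16 * ENNReal.ofReal (Real.exp 4))) with hCdom
  have hset : {C : Fin 4 → Matrix.specialUnitaryGroup (Fin 2) ℂ | |(su2Quat (C 3)).re| * ‖(su2Quat (C 3)).im‖ < ε} = {C | su2Quat (C 3) ∈ S} := by
    ext C; simp only [hSdef, Set.mem_setOf_eq]
  obtain ⟨-, hH, -⟩ := measurableSet_hubSet hS
  rw [hset, haar_sigmaBall_inter_hub_eq_lintegral ht.le hS]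
  -- bound the restricted hub integral through the dominator, then through the cap
  have hcap : MeasurableSet {a : ℍ | |a.re| * ‖a.im‖ < ε} :=
    measurableSet_lt ((measurable_quat_re.abs).mul measurable_quat_im.norm) measurable_const
  calc ∫⁻ a in {a : ℍ | radialUnit a ∈ S}, coneThree (transSet t (radialUnit (axisPoint a))) ∂coneMeasure
      = ∫⁻ a, {a : ℍ | radialUnit a ∈ S}.indicator (fun a => coneThree (transSet t (radialUnit (axisPoint a)))) a ∂coneMeasure :=
        (lintegral_indicator hH _).symm
    _ ≤ ∫⁻ a, {a : ℍ | |a.re| * ‖a.im‖ < ε}.indicator (fun a => ENNReal.ofReal (t ^ 7) * (ENNReal.ofReal coneConst ^ 3 * (Cdom * hubW a))) a ∂coneMeasure := by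
        refine lintegral_mono_ae ?_
        filter_upwards [coneThree_transSet_le_hubW ht, ae_cone_hub_good] with a hdom hgood
        obtain ⟨hre, -, hn⟩ := hgood
        have ha0 : a ≠ 0 := by intro h; rw [h] at hre; exact hre rfl
        by_cases hmem : radialUnit a ∈ S
        · have hcap' : a ∈ {a : ℍ | |a.re| * ‖a.im‖ < ε} := radialUnit_tip_subset_cap ha0 hn.le hmem
          rw [Set.indicator_of_mem (show a ∈ {a : ℍ | radialUnit a ∈ S} from hmem), Set.indicator_of_mem hcap']
          exact hdom
        · rw [Set.indicator_of_notMem (show a ∉ {a : ℍ | radialUnit a ∈ S} from hmem)]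
          exact bot_le
    _ = ENNReal.ofReal (t ^ 7) * (ENNReal.ofReal coneConst ^ 3 * (Cdom * ∫⁻ a in {a : ℍ | |a.re| * ‖a.im‖ < ε}, hubW a ∂coneMeasure)) := by
        rw [lintegral_indicator hcap, ← lintegral_const_mul _ measurable_hubW, ← lintegral_const_mul _ (measurable_hubW.const_mul _),
          ← lintegral_const_mul _ ((measurable_hubW.const_mul _).const_mul _)]
    _ ≤ _ := by
        gcongr ENNReal.ofReal (t ^ 7) * (ENNReal.ofReal coneConst ^ 3 * (Cdom * ?_))
        exact lintegral_cone_cap_hubW_le hε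

/-! ## §53 The tip share in Laplace form -/

/-- All constants of the tip share are finite. [folklore] -/
theorem tipConst_lt_top (ε : ℝ) :
    ENNReal.ofReal coneConst ^ 3 *
        ((4 * (ENNReal.ofReal (Real.pi ^ 2 / 12) * (Ising (1/3) * Ising (1/3))) * (16 * ENNReal.ofReal (Real.exp 4))) *
          (ENNReal.ofReal coneConst * (ENNReal.ofReal (ε ^ (1/18 : ℝ) * (3:ℝ) ^ (-(4/3 : ℝ))) * (Ising (7/18) * (Ising (4/9) * (Ising (4/9) * Ising (4/9)))) +
            ENNReal.ofReal (ε ^ (1/36 : ℝ) * (3:ℝ) ^ (-(4/3 : ℝ))) * (Ising (1/3) * (Ising (17/36) * (Ising (4/9) * Ising (4/9))))))) < ∞ := by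
  have hI := Ising_lt_top (c := 1/3) (by norm_num) (by norm_num)
  obtain ⟨h1, h2⟩ := capConst_lt_top
  refine ENNReal.mul_lt_top (ENNReal.pow_lt_top ENNReal.ofReal_lt_top) (ENNReal.mul_lt_top ?_ ?_)
  · exact ENNReal.mul_lt_top (ENNReal.mul_lt_top (by simp) (ENNReal.mul_lt_top ENNReal.ofReal_lt_top (ENNReal.mul_lt_top hI hI)))
      (ENNReal.mul_lt_top (by simp) ENNReal.ofReal_lt_top)
  · exact ENNReal.mul_lt_top ENNReal.ofReal_lt_top (ENNReal.add_lt_top.2 ⟨ENNReal.mul_lt_top ENNReal.ofReal_lt_top h1, ENNReal.mul_lt_top ENNReal.ofReal_lt_top h2⟩)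

/-- The Gamma moment `∫_{(0,∞)} s^{7/2}·βe^{−βs} ds = Γ(9/2)·β^{−7/2}` (`β > 0`), as a lower integral. [folklore] -/
theorem lintegral_Ioi_rpow_sevenHalves_exp_density {β : ℝ} (hβ : 0 < β) :
    ∫⁻ s in Ioi (0:ℝ), ENNReal.ofReal (s ^ ((7:ℝ) / 2)) * ENNReal.ofReal (β * Real.exp (-(β * s))) =
      ENNReal.ofReal (Real.Gamma ((9:ℝ) / 2) * β ^ (-((7:ℝ) / 2))) := by
  have hG := Real.integral_rpow_mul_exp_neg_mul_Ioi (a := (9:ℝ) / 2) (r := β) (by norm_num) hβ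
  have h72 : (9:ℝ) / 2 - 1 = 7 / 2 := by norm_num
  rw [h72] at hG
  -- integrability of the Gamma integrand (its integral is non-zero)
  have hint : IntegrableOn (fun s : ℝ => s ^ ((7:ℝ) / 2) * Real.exp (-(β * s))) (Ioi 0) := by
    by_contra hni
    have h0 := integral_undef hni
    rw [h0] at hG
    have : 0 < (1 / β) ^ ((9:ℝ) / 2) * Real.Gamma ((9:ℝ) / 2) := by
      have := Real.Gamma_pos_of_pos (show (0:ℝ) < 9 / 2 by norm_num); positivity
    linarith
  have hint' : IntegrableOn (fun s : ℝ => s ^ ((7:ℝ) / 2) * (β * Real.exp (-(β * s)))) (Ioi 0) := by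
    have h : IntegrableOn (fun s : ℝ => β * (s ^ ((7:ℝ) / 2) * Real.exp (-(β * s)))) (Ioi 0) := hint.const_mul β
    exact h.congr_fun (fun s _ => by ring) measurableSet_Ioi
  have hnn : 0 ≤ᵐ[volume.restrict (Ioi (0:ℝ))] fun s => s ^ ((7:ℝ) / 2) * (β * Real.exp (-(β * s))) := by
    filter_upwards [ae_restrict_mem measurableSet_Ioi] with s hs
    have : 0 < s := hs
    positivity
  have heq : ∫⁻ s in Ioi (0:ℝ), ENNReal.ofReal (s ^ ((7:ℝ) / 2)) * ENNReal.ofReal (β * Real.exp (-(β * s))) =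
      ∫⁻ s in Ioi (0:ℝ), ENNReal.ofReal (s ^ ((7:ℝ) / 2) * (β * Real.exp (-(β * s)))) := by
    refine setLIntegral_congr_fun measurableSet_Ioi (fun s hs => ?_)
    rw [ENNReal.ofReal_mul (Real.rpow_nonneg (le_of_lt hs) _)]
  rw [heq, ← ofReal_integral_eq_lintegral_ofReal hint' hnn]
  congr 1
  have e2 : ∫ s in Ioi (0:ℝ), s ^ ((7:ℝ) / 2) * (β * Real.exp (-(β * s))) = β * ∫ s in Ioi (0:ℝ), s ^ ((7:ℝ) / 2) * Real.exp (-(β * s)) := by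
    rw [← integral_const_mul]
    refine integral_congr_ae (Filter.Eventually.of_forall fun s => ?_)
    ring
  rw [e2, hG, Real.div_rpow zero_le_one hβ.le, Real.one_rpow,
    show -((7:ℝ) / 2) = 1 - (9:ℝ) / 2 by norm_num, Real.rpow_sub hβ, Real.rpow_one]
  field_simp

/-- ★★★ **THE HUB-TIP SHARE IN LAPLACE FORM** (LEAD g97's (T4)): for all `β > 0`, `ε > 0`,
`∫_{ {C : |re u₃|·‖Im u₃‖ < ε} } e^{−β·sigmaMaxSq(C)} dHaar⁴(C) ≤ Γ(9/2)·β^{−7/2} · (coneConst³·C_dom·Cap(ε))` — the tip of the σ-glued zero-mode block carries at most a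
`C·ε^{1/36}` share of the `β^{−7/2}` law, uniformly in `β`; no `β^{−κ}` correction. [cite: GonzalezarroyoAltes1988] [cite: Vanbaal2001] [cite: Luscher1983, §2] -/
theorem lintegral_hubTip_exp_neg_sigmaMaxSq_le {β ε : ℝ} (hβ : 0 < β) (hε : 0 < ε) :
    ∫⁻ C in {C : Fin 4 → Matrix.specialUnitaryGroup (Fin 2) ℂ | |(su2Quat (C 3)).re| * ‖(su2Quat (C 3)).im‖ < ε},
        ENNReal.ofReal (Real.exp (-(β * sigmaMaxSq C))) ∂(Measure.pi fun _ : Fin 4 => haarProbability (Matrix.specialUnitaryGroup (Fin 2) ℂ)) ≤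
      ENNReal.ofReal (Real.Gamma ((9:ℝ) / 2) * β ^ (-((7:ℝ) / 2))) * (ENNReal.ofReal coneConst ^ 3 *
        ((4 * (ENNReal.ofReal (Real.pi ^ 2 / 12) * (Ising (1/3) * Ising (1/3))) * (16 * ENNReal.ofReal (Real.exp 4))) *
          (ENNReal.ofReal coneConst * (ENNReal.ofReal (ε ^ (1/18 : ℝ) * (3:ℝ) ^ (-(4/3 : ℝ))) * (Ising (7/18) * (Ising (4/9) * (Ising (4/9) * Ising (4/9)))) +
            ENNReal.ofReal (ε ^ (1/36 : ℝ) * (3:ℝ) ^ (-(4/3 : ℝ))) * (Ising (1/3) * (Ising (17/36) * (Ising (4/9) * Ising (4/9)))))))) := by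
  set Tip : Set (Fin 4 → Matrix.specialUnitaryGroup (Fin 2) ℂ) := {C | |(su2Quat (C 3)).re| * ‖(su2Quat (C 3)).im‖ < ε} with hTipdef
  set W : ℝ≥0∞ := ENNReal.ofReal coneConst ^ 3 *
        ((4 * (ENNReal.ofReal (Real.pi ^ 2 / 12) * (Ising (1/3) * Ising (1/3))) * (16 * ENNReal.ofReal (Real.exp 4))) *
          (ENNReal.ofReal coneConst * (ENNReal.ofReal (ε ^ (1/18 : ℝ) * (3:ℝ) ^ (-(4/3 : ℝ))) * (Ising (7/18) * (Ising (4/9) * (Ising (4/9) * Ising (4/9)))) +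
            ENNReal.ofReal (ε ^ (1/36 : ℝ) * (3:ℝ) ^ (-(4/3 : ℝ))) * (Ising (1/3) * (Ising (17/36) * (Ising (4/9) * Ising (4/9))))))) with hW
  have hTip : MeasurableSet Tip :=
    measurableSet_lt (((measurable_quat_re.comp (continuous_su2Quat.measurable.comp (measurable_pi_apply 3))).abs).mul
      ((measurable_quat_im.comp (continuous_su2Quat.measurable.comp (measurable_pi_apply 3))).norm)) measurable_const
  set μ4 := (Measure.pi fun _ : Fin 4 => haarProbability (Matrix.specialUnitaryGroup (Fin 2) ℂ)) with hμ4
  set μ : Measure (Fin 4 → Matrix.specialUnitaryGroup (Fin 2) ℂ) := μ4.restrict Tip with hμ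
  haveI : IsFiniteMeasure μ := by rw [hμ]; infer_instance
  -- the distribution function of `sigmaMaxSq` under the tip-restricted Haar measure
  have hbound : ∀ s : ℝ, 0 < s → μ {C | sigmaMaxSq C ≤ s} ≤ ENNReal.ofReal (s ^ ((7:ℝ) / 2)) * W := by
    intro s hs
    have hsq : 0 < Real.sqrt s := Real.sqrt_pos.2 hs
    rw [hμ, Measure.restrict_apply (measurableSet_le measurable_sigmaMaxSq measurable_const), setOf_sigmaMaxSq_le hs.le]
    have h := haar_sigmaBall_inter_hubTip_le (t := Real.sqrt s) hsq hε
    have e7 : Real.sqrt s ^ 7 = s ^ ((7:ℝ) / 2) := by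
      rw [Real.sqrt_eq_rpow, ← Real.rpow_natCast, ← Real.rpow_mul hs.le]; norm_num
    rw [e7] at h
    exact h
  rw [lintegral_exp_neg_mul_eq_layerCake μ measurable_sigmaMaxSq (fun C => sq_nonneg _) hβ]
  calc ∫⁻ s in Ioi (0:ℝ), μ {C | sigmaMaxSq C ≤ s} * ENNReal.ofReal (β * Real.exp (-(β * s)))
      ≤ ∫⁻ s in Ioi (0:ℝ), (ENNReal.ofReal (s ^ ((7:ℝ) / 2)) * W) * ENNReal.ofReal (β * Real.exp (-(β * s))) :=
        setLIntegral_mono' measurableSet_Ioi fun s hs => by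
          gcongr ?_ * _
          exact hbound s hs
    _ = W * ∫⁻ s in Ioi (0:ℝ), ENNReal.ofReal (s ^ ((7:ℝ) / 2)) * ENNReal.ofReal (β * Real.exp (-(β * s))) := by
        rw [← lintegral_const_mul' _ _ (tipConst_lt_top ε).ne]
        refine lintegral_congr fun s => ?_
        ring
    _ = W * ENNReal.ofReal (Real.Gamma ((9:ℝ) / 2) * β ^ (-((7:ℝ) / 2))) := by rw [lintegral_Ioi_rpow_sevenHalves_exp_density hβ]
    _ = _ := mul_comm _ _

end Summit.QuantumFields.YangMills.Theorems.SwapVirialDeficit.ZeroModeSigma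

end
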